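import Summits.BirchSwinnertonDyer.BirchSwinnertonDyer.Theorems.ByReductionTypeAtTwoAnalyticMuCertificate
import Literature.NumberTheory.EllipticCurves.PAdicLFunctionIntegralityAtTwoAutoProofs
import Literature.NumberTheory.EllipticCurves.PAdicLFunctionInterpolationHoldsProofs
import Literature.NumberTheory.EllipticCurves.PAdicLFunctionNeZeroProofs
import Literature.NumberTheory.EllipticCurves.PAdicLFunctionProofs
import Mathlib.Algebra.Group.ForwardDiff
import HarnessLib

/-!
# Route `ByReductionTypeAtTwo` (K4), crux `OrdMissingLowerBoundAtTwo` (stmt-BirchSwinnertonDyer-19577), line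
# `kato-free-lower-sandwich-two` — LEMMAS for S2 (analytic half) at every depth: periodic forward differences and the
# sharpened Lucas congruence of the `2`-adic Riemann sums (`--supports`, helper)

Cell `bsd-2adic`, lead `cruxlead-stmt-BirchSwinnertonDyer-19577` (g0).  THEOREMS ONLY — no definition, no named fact, no
`sorry`; closes nothing; BSD is not proved by any of this.  Consumed by `…Theorems.ByReductionTypeAtTwoAnalyticMuDepth`.

* §1 forward differences of a `2ⁿ`-PERIODIC integer-valued function: `2^{⌊k/2ⁿ⌋} ∣ Δᵏg`
  (`(E−1)^{2ⁿ} ≡ E^{2ⁿ} − 1 (mod 2)`): the Mahler–Newton coefficients of the indicator of a class mod `2ⁿ` decay 2-adically.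
* §2 the SHARPENED Lucas congruence `2^{j+1} ∣ C(x,k) − C(y,k)` for `x ≡ y (mod 2^{n+j})`, `k < 2ⁿ` (Vandermonde +
  `v₂(C(d,i)) ≥ v₂(d) − v₂(i)`), hence `‖c_k − RS(k,M)‖₂ ≤ 2^{-(j+1)}` for the Riemann sums of `L₂(f,α,T)` at level
  `M ≥ n + j` (the tree's `norm_padicLRiemannSum_two_sub_le_half` / `norm_natCast_choose_sub_choose_le_half` are `j = 0`).

References: B. Mazur, J. Tate, J. Teitelbaum, Invent. Math. 84 (1986), §I.11–I.13; L. Washington, GTM 83, §7.2.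
-/

-- the summit namespace repeats `BirchSwinnertonDyer` by design (summit = problem); linter moot
set_option linter.dupNamespace false
set_option autoImplicit false

noncomputable section

namespace Summit.BirchSwinnertonDyer.BirchSwinnertonDyer.Theorems.AnalyticMuTwo

open Filter Topology Finset
open scoped MatrixGroups ModularForm fwdDiff
open CongruenceSubgroup WeierstrassCurve Literature.NumberTheory.EllipticCurves
  Literature.NumberTheory.EllipticCurves.ModularForms Literature.NumberTheory.EllipticCurves.Rank1Residual

/-! ## §1 Forward differences of a periodic integer-valued function -/

section Periodic

/-- Iterated forward differences commute with an integer scalar. [folklore] -/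
theorem fwdDiff_iter_const_mul (c : ℤ) (f : ℕ → ℤ) (m : ℕ) :
    (Δ_[1])^[m] (fun x => c * f x) = fun x => c * (Δ_[1])^[m] f x := by
  induction m with
  | zero => rfl
  | succ m ih =>
    simp only [Function.iterate_succ', Function.comp_apply, ih]
    funext x
    simp only [fwdDiff, mul_sub]

/-- Iterated forward differences of a `T`-periodic function are `T`-periodic. [folklore] -/
theorem fwdDiff_iter_periodic {f : ℕ → ℤ} {T : ℕ} (hper : ∀ x, f (x + T) = f x) (m x : ℕ) :
    (Δ_[1])^[m] f (x + T) = (Δ_[1])^[m] f x := by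
  rw [← fwdDiff_iter_comp_add]
  have hf : (fun r => f (r + T)) = f := funext hper
  rw [hf]

/-- If every value of `f` is divisible by `d`, so is every iterated forward difference. [folklore] -/
theorem dvd_fwdDiff_iter {f : ℕ → ℤ} {d : ℤ} (h : ∀ x, d ∣ f x) (m x : ℕ) : d ∣ (Δ_[1])^[m] f x := by
  induction m generalizing x with
  | zero => exact h x
  | succ m ih =>
    rw [Function.iterate_succ', Function.comp_apply]
    exact dvd_sub (ih _) (ih _)

/-- The `2ⁿ`-th forward difference of a `2ⁿ`-periodic integer-valued function is EVEN (`n ≥ 1`):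
`Δ^{2ⁿ} g (x) = Σ_k (−1)^{2ⁿ−k} C(2ⁿ,k) g(x+k)`, the two extreme terms give `2g(x)` (periodicity) and the middle binomials
`C(2ⁿ,k)`, `0 < k < 2ⁿ`, are even. [folklore] -/
theorem two_dvd_fwdDiff_iter_two_pow {g : ℕ → ℤ} {n : ℕ} (hn : 1 ≤ n) (hper : ∀ x, g (x + 2 ^ n) = g x)
    (x : ℕ) : (2 : ℤ) ∣ (Δ_[1])^[2 ^ n] g x := by
  rw [fwdDiff_iter_eq_sum_shift]
  simp only [smul_eq_mul, mul_one]
  -- split off the terms k = 0 and k = 2^n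
  have h2n : 0 < 2 ^ n := pow_pos two_pos n
  rw [Finset.sum_range_succ, ← Finset.add_sum_erase _ _ (Finset.mem_range.mpr h2n)]
  have hmid : (2 : ℤ) ∣ ∑ k ∈ (range (2 ^ n)).erase 0, ((-1 : ℤ) ^ (2 ^ n - k) * ((2 ^ n).choose k : ℕ)) * g (x + k) := by
    refine Finset.dvd_sum fun k hk => ?_
    rw [Finset.mem_erase, Finset.mem_range] at hk
    have hdvd : 2 ∣ (2 ^ n).choose k := (Nat.prime_two.dvd_choose_pow_iff).mpr ⟨hk.1, hk.2.ne⟩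
    exact Dvd.dvd.mul_right (Dvd.dvd.mul_left (by exact_mod_cast hdvd) _) _
  have hends : ((-1 : ℤ) ^ (2 ^ n - 0) * ((2 ^ n).choose 0 : ℕ)) * g (x + 0) +
      ((-1 : ℤ) ^ (2 ^ n - 2 ^ n) * ((2 ^ n).choose (2 ^ n) : ℕ)) * g (x + 2 ^ n) = 2 * g x := by
    have heven : Even (2 ^ n) := by
      rw [show 2 ^ n = 2 * 2 ^ (n - 1) by rw [← pow_succ']; congr 1; omega]
      exact even_two_mul _
    simp [heven.neg_one_pow, hper x]
    ring
  rw [add_assoc, add_left_comm, hends]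
  exact dvd_add hmid (dvd_mul_right 2 _)

/-- `2^r ∣ Δ^{2ⁿ·r} g` for a `2ⁿ`-periodic integer-valued `g` (`n ≥ 1`): iterate `Δ^{2ⁿ} g = 2·G` with `G` again periodic
and integer-valued. [folklore] -/
theorem two_pow_div_dvd_fwdDiff_iter {n : ℕ} (hn : 1 ≤ n) :
    ∀ (r : ℕ) (g : ℕ → ℤ), (∀ x, g (x + 2 ^ n) = g x) → ∀ x, (2 : ℤ) ^ r ∣ (Δ_[1])^[2 ^ n * r] g x := by
  intro r
  induction r with
  | zero => intro g _ x; simp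
  | succ r ih =>
    intro g hper x
    -- `Δ^{2ⁿ} g = 2 G` with `G` periodic
    have h2 := two_dvd_fwdDiff_iter_two_pow hn hper
    set G : ℕ → ℤ := fun y => (Δ_[1])^[2 ^ n] g y / 2 with hG
    have hGeq : (fun y => 2 * G y) = (Δ_[1])^[2 ^ n] g := by
      funext y; rw [hG]; exact Int.mul_ediv_cancel' (h2 y)
    have hGper : ∀ y, G (y + 2 ^ n) = G y := by
      intro y; simp only [hG, fwdDiff_iter_periodic hper]
    rw [mul_add, mul_one, Function.iterate_add_apply, ← hGeq, fwdDiff_iter_const_mul, pow_succ']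
    exact mul_dvd_mul_left 2 (ih G hGper x)

/-- **`2^{⌊k/2ⁿ⌋} ∣ Δᵏg` for a `2ⁿ`-periodic integer-valued `g` (`n ≥ 1`)**: the Mahler–Newton coefficients of a locally
constant function decay. [cite: Washington1997, §7.2] -/
theorem two_pow_dvd_fwdDiff_iter_of_periodic {n : ℕ} (hn : 1 ≤ n) {g : ℕ → ℤ}
    (hper : ∀ x, g (x + 2 ^ n) = g x) (k x : ℕ) : (2 : ℤ) ^ (k / 2 ^ n) ∣ (Δ_[1])^[k] g x := by
  have hk : k = k % 2 ^ n + 2 ^ n * (k / 2 ^ n) := (Nat.mod_add_div k (2 ^ n)).symm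
  conv_rhs => rw [hk]
  rw [Function.iterate_add_apply]
  exact dvd_fwdDiff_iter (two_pow_div_dvd_fwdDiff_iter hn (k / 2 ^ n) g hper) _ _

end Periodic

/-! ## §2 The sharpened Lucas congruence and the Riemann sums to depth `j` -/

section Lucas

/-- `2^{j+1} ∣ C(d,i)` for `2^{n+j} ∣ d` and `0 < i < 2ⁿ` (`i·C(d,i) = d·C(d−1,i−1)`, `v₂(i) ≤ n − 1`). [folklore] -/
theorem two_pow_dvd_choose_of_dvd {d i n j : ℕ} (hd : 2 ^ (n + j) ∣ d) (hi0 : 0 < i) (hi : i < 2 ^ n) :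
    2 ^ (j + 1) ∣ d.choose i := by
  haveI : Fact (Nat.Prime 2) := ⟨Nat.prime_two⟩
  rcases Nat.eq_zero_or_pos d with rfl | hdpos
  · rw [Nat.choose_eq_zero_of_lt hi0]; exact dvd_zero _
  by_cases hc : d.choose i = 0
  · rw [hc]; exact dvd_zero _
  -- `d * C(d-1, i-1) = C(d, i) * i`
  obtain ⟨d', rfl⟩ : ∃ d', d = d' + 1 := ⟨d - 1, by omega⟩
  obtain ⟨i', rfl⟩ : ∃ i', i = i' + 1 := ⟨i - 1, by omega⟩
  have key : (d' + 1) * d'.choose i' = (d' + 1).choose (i' + 1) * (i' + 1) := Nat.add_one_mul_choose_eq d' i'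
  have hc' : d'.choose i' ≠ 0 := by
    intro h0
    rw [h0, mul_zero] at key
    exact hc (by
      have := key.symm
      rcases Nat.mul_eq_zero.mp this with h | h
      · exact h
      · omega)
  have hv := congrArg (padicValNat 2) key
  rw [padicValNat.mul (by omega) hc', padicValNat.mul hc (by omega)] at hv
  have hvd : n + j ≤ padicValNat 2 (d' + 1) :=
    (padicValNat_dvd_iff_le (by omega)).mp hd
  have hvi : padicValNat 2 (i' + 1) < n := by
    by_contra hge
    push Not at hge
    have : 2 ^ n ∣ i' + 1 := (padicValNat_dvd_iff_le (by omega)).mpr hge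
    exact absurd (Nat.le_of_dvd (by omega) this) (not_le.mpr hi)
  exact (padicValNat_dvd_iff_le hc).mpr (by omega)

/-- `2^{j+1} ∣ C(x,k) − C(y,k)` for `y ≤ x`, `2^{n+j} ∣ x − y`, `k < 2ⁿ` (Vandermonde: `C(y+d,k) − C(y,k) =
Σ_{i ≥ 1} C(d,i)·C(y,k−i)`). [folklore] -/
theorem two_pow_dvd_choose_sub_choose {x y n j k : ℕ} (hyx : y ≤ x) (h : 2 ^ (n + j) ∣ x - y) (hk : k < 2 ^ n) :
    2 ^ (j + 1) ∣ x.choose k - y.choose k ∧ y.choose k ≤ x.choose k := by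
  obtain ⟨d, rfl⟩ : ∃ d, x = d + y := ⟨x - y, by omega⟩
  rw [Nat.add_sub_cancel] at h
  rw [Nat.add_choose_eq]
  -- the term `(0, k)` of the antidiagonal is `C(y,k)`; the others are divisible by `2^{j+1}`
  have hmem : ((0, k) : ℕ × ℕ) ∈ antidiagonal k := by simp
  rw [← Finset.add_sum_erase _ _ hmem]
  simp only [Nat.choose_zero_right, one_mul]
  refine ⟨?_, Nat.le_add_right _ _⟩
  rw [Nat.add_sub_cancel_left]
  refine Finset.dvd_sum fun ij hij => ?_
  rw [Finset.mem_erase, Finset.HasAntidiagonal.mem_antidiagonal] at hij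
  have hi0 : 0 < ij.1 := by
    rcases ij with ⟨i, l⟩
    simp only [ne_eq, Prod.mk.injEq] at hij ⊢
    by_contra h0
    push Not at h0
    have : i = 0 := by omega
    exact hij.1 ⟨this, by omega⟩
  exact Dvd.dvd.mul_right (two_pow_dvd_choose_of_dvd h hi0 (by omega)) _

/-- **Sharpened Lucas at `2`**: `‖C(x,k) − C(y,k)‖₂ ≤ 2^{-(j+1)}` for `x ≡ y (mod 2^{n+j})` and `k < 2ⁿ` (the tree's
`norm_natCast_choose_sub_choose_le_half` is `j = 0`). [cite: MazurTateTeitelbaum1986Invent, §I.12–I.13] -/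
theorem norm_natCast_choose_sub_choose_le_two_zpow {x y n j k : ℕ} (h : x ≡ y [MOD 2 ^ (n + j)])
    (hk : k < 2 ^ n) : ‖((x.choose k : ℕ) : ℚ_[2]) - (y.choose k : ℕ)‖ ≤ (2 : ℝ) ^ (-((j : ℤ) + 1)) := by
  haveI : Fact (Nat.Prime 2) := ⟨Nat.prime_two⟩
  wlog hyx : y ≤ x generalizing x y
  · rw [norm_sub_rev]; exact this h.symm (by omega)
  obtain ⟨hdvd, hle⟩ := two_pow_dvd_choose_sub_choose hyx ((Nat.modEq_iff_dvd' hyx).mp h.symm) hk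
  have hcast : ((x.choose k : ℕ) : ℚ_[2]) - (y.choose k : ℕ) = (((x.choose k - y.choose k : ℕ) : ℤ) : ℚ_[2]) := by
    push_cast [Nat.cast_sub hle]; ring
  rw [hcast]
  have := (Padic.norm_int_le_pow_iff_dvd ((x.choose k - y.choose k : ℕ) : ℤ) (j + 1)).mpr (by exact_mod_cast hdvd)
  exact_mod_cast this



variable {N : ℕ} [NeZero N] (f : CuspForm (Gamma0 N) 2) (α : ℚ_[2])

/-- **The `2`-adic Riemann sums to depth `j`**: for `k < 2ⁿ` and `n + j ≤ m`, `‖RS(k,m) − RS(k,n+j)‖₂ ≤ 2^{-(j+1)}`,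
granted the distribution relation of `μ_{f,α}` and `‖μ_{f,α}‖ ≤ 2` (one step `m → m+1`: regroup over the fibres of
`ℤ/2ᵐ⁺¹ → ℤ/2ᵐ`, a class contributes `ν_{m+1}(s')·(C(s',k) − C(s' mod 2ᵐ,k))` of norm `≤ 2^{-(m−n+1)}`).  The tree's
`norm_padicLRiemannSum_two_sub_le_half` is `j = 0`. [cite: MazurTateTeitelbaum1986Invent, §I.12–I.13] -/
theorem norm_padicLRiemannSum_two_sub_le_zpow
    (hdist : ∀ (n : ℕ) (a : ZMod (2 ^ n)),
      ∑ b ∈ Finset.univ.filter (fun b : ZMod (2 ^ (n + 1)) ↦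
        ZMod.castHom (pow_dvd_pow 2 n.le_succ) (ZMod (2 ^ n)) b = a), msdMeasure f α (n + 1) b =
        msdMeasure f α n a)
    (hμ : ∀ (m : ℕ) (a : ZMod (2 ^ m)), ‖msdMeasure f α m a‖ ≤ 2)
    {k n j : ℕ} (hk : k < 2 ^ n) {m : ℕ} (hnm : n + j ≤ m) :
    ‖padicLRiemannSum f α k m - padicLRiemannSum f α k (n + j)‖ ≤ (2 : ℝ) ^ (-((j : ℤ) + 1)) := by
  classical
  have h2norm : ‖(2 : ℚ_[2])‖ = 2⁻¹ := by simpa using Padic.norm_p (p := 2)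
  have hν : ∀ (m : ℕ) (a : ZMod (2 ^ (m + 2))), ‖2 * msdMeasure f α (m + 2) a‖ ≤ 1 := by
    intro m a
    rw [norm_mul, h2norm]
    calc (2 : ℝ)⁻¹ * ‖msdMeasure f α (m + 2) a‖ ≤ 2⁻¹ * 2 := by gcongr; exact hμ _ _
      _ = 1 := by norm_num
  have hB0 : (0 : ℝ) ≤ (2 : ℝ) ^ (-((j : ℤ) + 1)) := zpow_nonneg (by norm_num) _
  -- one step
  have hstep : ∀ m : ℕ, n + j ≤ m →
      ‖padicLRiemannSum f α k (m + 1) - padicLRiemannSum f α k m‖ ≤ (2 : ℝ) ^ (-((j : ℤ) + 1)) := by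
    intro m hm
    haveI : NeZero (2 ^ m) := ⟨pow_ne_zero _ two_ne_zero⟩
    haveI : NeZero (2 ^ (m + 1)) := ⟨pow_ne_zero _ two_ne_zero⟩
    set π : ZMod (2 ^ (m + 1)) → ZMod (2 ^ m) :=
      fun s' ↦ ZMod.castHom (pow_dvd_pow 2 m.le_succ) (ZMod (2 ^ m)) s' with hπ
    have hπval : ∀ s' : ZMod (2 ^ (m + 1)), (π s').val = s'.val % 2 ^ m := by
      intro s'
      rw [hπ]
      dsimp only
      rw [ZMod.castHom_apply, ZMod.cast_eq_val, ZMod.val_natCast]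
    have hRSm : padicLRiemannSum f α k m = ∑ s' : ZMod (2 ^ (m + 1)),
        (2 * msdMeasure f α (m + 1 + 2) ((cyclotomicGenerator 2 : ZMod (2 ^ (m + 1 + 2))) ^ s'.val)) *
          (((π s').val.choose k : ℕ) : ℚ_[2]) := by
      rw [padicLRiemannSum_two_eq_sum]
      rw [← Finset.sum_fiberwise (Finset.univ : Finset (ZMod (2 ^ (m + 1)))) π]
      refine Finset.sum_congr rfl fun s _ ↦ ?_
      rw [← sum_fiber_two_mul_msdMeasure_succ_eq f α hdist m s, Finset.sum_mul]
      refine Finset.sum_congr rfl fun s' hs' ↦ ?_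
      have hs'' : π s' = s := (Finset.mem_filter.mp hs').2
      rw [hs'']
    rw [hRSm, padicLRiemannSum_two_eq_sum, ← Finset.sum_sub_distrib]
    refine IsUltrametricDist.norm_sum_le_of_forall_le_of_nonneg hB0 fun s' _ ↦ ?_
    rw [← mul_sub, norm_mul]
    have hmod : s'.val ≡ (π s').val [MOD 2 ^ (n + j)] := by
      rw [hπval]
      exact ((Nat.mod_modEq _ _).symm).of_dvd (pow_dvd_pow 2 hm)
    have hL : ‖((s'.val.choose k : ℕ) : ℚ_[2]) - (((π s').val.choose k : ℕ) : ℚ_[2])‖ ≤ (2 : ℝ) ^ (-((j : ℤ) + 1)) :=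
      norm_natCast_choose_sub_choose_le_two_zpow hmod hk
    calc _ ≤ 1 * (2 : ℝ) ^ (-((j : ℤ) + 1)) := mul_le_mul (hν _ _) hL (norm_nonneg _) zero_le_one
      _ = _ := one_mul _
  -- telescope
  induction m, hnm using Nat.le_induction with
  | base =>
    rw [sub_self, norm_zero]
    exact hB0
  | succ m hnm ih =>
    calc ‖padicLRiemannSum f α k (m + 1) - padicLRiemannSum f α k (n + j)‖
        = ‖(padicLRiemannSum f α k (m + 1) - padicLRiemannSum f α k m) +
            (padicLRiemannSum f α k m - padicLRiemannSum f α k (n + j))‖ := by rw [sub_add_sub_cancel]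
      _ ≤ max ‖padicLRiemannSum f α k (m + 1) - padicLRiemannSum f α k m‖
            ‖padicLRiemannSum f α k m - padicLRiemannSum f α k (n + j)‖ :=
          IsUltrametricDist.norm_add_le_max _ _
      _ ≤ _ := max_le (hstep m hnm) ih

/-- **The coefficients are `2^{-(j+1)}`-close to the Riemann sums**: `‖c_k − RS(k,M)‖₂ ≤ 2^{-(j+1)}` for `k < 2ⁿ`,
`M ≥ n + j` (`c_k = lim RS(k,·)`, `tendsto_padicLRiemannSum_of_norm_le`). [cite: MazurTateTeitelbaum1986Invent, §I.11–I.13] -/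
theorem norm_padicLCoeff_sub_padicLRiemannSum_le_zpow
    (hdist : ∀ (n : ℕ) (a : ZMod (2 ^ n)),
      ∑ b ∈ Finset.univ.filter (fun b : ZMod (2 ^ (n + 1)) ↦
        ZMod.castHom (pow_dvd_pow 2 n.le_succ) (ZMod (2 ^ n)) b = a), msdMeasure f α (n + 1) b =
        msdMeasure f α n a)
    (hμ : ∀ (m : ℕ) (a : ZMod (2 ^ m)), ‖msdMeasure f α m a‖ ≤ 2)
    {k n j M : ℕ} (hk : k < 2 ^ n) (hM : n + j ≤ M) :
    ‖padicLCoeff f α k - padicLRiemannSum f α k M‖ ≤ (2 : ℝ) ^ (-((j : ℤ) + 1)) := by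
  have hlim : Tendsto (fun m ↦ padicLRiemannSum f α k m - padicLRiemannSum f α k (n + j)) atTop
      (𝓝 (padicLCoeff f α k - padicLRiemannSum f α k (n + j))) :=
    (tendsto_padicLRiemannSum_of_norm_le hdist ⟨2, hμ⟩ k).sub tendsto_const_nhds
  have herr : ‖padicLCoeff f α k - padicLRiemannSum f α k (n + j)‖ ≤ (2 : ℝ) ^ (-((j : ℤ) + 1)) := by
    refine le_of_tendsto hlim.norm ?_
    filter_upwards [eventually_ge_atTop (n + j)] with m hm
    exact norm_padicLRiemannSum_two_sub_le_zpow f α hdist hμ hk hm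
  calc ‖padicLCoeff f α k - padicLRiemannSum f α k M‖
      = ‖(padicLCoeff f α k - padicLRiemannSum f α k (n + j)) +
          -(padicLRiemannSum f α k M - padicLRiemannSum f α k (n + j))‖ := by congr 1; ring
    _ ≤ max ‖padicLCoeff f α k - padicLRiemannSum f α k (n + j)‖
          ‖-(padicLRiemannSum f α k M - padicLRiemannSum f α k (n + j))‖ := Padic.nonarchimedean _ _
    _ ≤ _ := by
        rw [norm_neg]
        exact max_le herr (norm_padicLRiemannSum_two_sub_le_zpow f α hdist hμ hk hM)

end Lucas

end Summit.BirchSwinnertonDyer.BirchSwinnertonDyer.Theorems.AnalyticMuTwo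

end
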